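import Literature.MathematicalPhysics.QuantumLattice.HubbardWave0
import HarnessLib

/-!
# Hubbard family — wave 0: proofs for hubbard.S06 (`ρ₂ ≥ 0`, `tr ρ₂ = N(N − 1)`)

Trunk T-QLATTICE, family `hubbard`. One of the companion ("Proofs") files of
`HubbardWave0.lean` (the sibling `HubbardWave0Proofs` treats hubbard.S07), discharging the
named fact `Literature.MathematicalPhysics.QuantumLattice.twoParticleRDM_posSemidef_and_trace` (statement id hubbard.S06;
C. N. Yang, *Concept of off-diagonal long-range order and the quantum phases of liquid He and
of superconductors*, Rev. Mod. Phys. **34** (1962) 694, §3): for a normalised `N`-particle Fock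
vector `ψ`, Yang's two-particle reduced density matrix `ρ₂((i,j),(k,l)) = ⟨ψ, c†_i c†_j c_l c_k ψ⟩`
is positive semidefinite and `tr ρ₂ = N(N − 1)`.

## Proof architecture (standard; all objects are the concrete Jordan–Wigner matrices of Wave0;
auxiliary lemmas live in the namespace `Literature.Hubbard.PosSemidefTrace`)

* `annihilation_mulVec_apply`: `(c_i φ)(s) = jwSign i s · φ(s ∪ {i})` for `i ∉ s`, else `0`.
* `twoParticleRDM_apply`: since `c†_i c†_j = (c_j c_i)ᴴ`,
  `ρ₂((i,j),(k,l)) = ⟨c_j c_i ψ, c_l c_k ψ⟩`; hence `ρ₂ = Bᴴ B` for `B(s,(i,j)) = (c_j c_i ψ)(s)`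
  and `ρ₂` is positive semidefinite by `Matrix.posSemidef_conjTranspose_mul_self`
  (`twoParticleRDM_posSemidef`, valid for every `ψ`).
* `sum_star_annihilation_mulVec_dotProduct`: `Σ_i ‖c_i φ‖² = Σ_t |t| · |φ t|²` (i.e.
  `Σ_i c†_i c_i` is the number operator), which equals `M ‖φ‖²` on an `M`-particle vector; as
  `c_i ψ` is an `(N − 1)`-particle vector (`isNParticle_annihilation_mulVec`),
  `tr ρ₂ = Σ_i Σ_j ‖c_j (c_i ψ)‖² = (N − 1) Σ_i ‖c_i ψ‖² = (N − 1) N ‖ψ‖²`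
  (`twoParticleRDM_trace`).

## References

* C. N. Yang, Rev. Mod. Phys. 34 (1962) 694, §3 (bibkey `YangODLRO1962`; the normalisation
  `Tr ρ₂ = N(N − 1)` and positivity of the reduced density matrices).
* T. Xiang, C. Wu, *D-wave Superconductivity*, CUP (2022), §1, eq. (1.69), p. 26 (bibkey
  `XiangWu2022`; "ρ and ρ₂ are semi-positive definite").
* H. Tasaki, *Physics and Mathematics of Quantum Many-Body Systems* (2020), §9.2 (fermion
  operators, number operator).
-/

namespace Literature.MathematicalPhysics.QuantumLattice

open Matrix Finset
open scoped ComplexOrder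

/-! ### Auxiliary lemmas (namespace `Literature.Hubbard.PosSemidefTrace`, to keep the shared
`Literature.Hubbard` namespace free for the sibling Proofs files of `HubbardWave0`) -/

namespace PosSemidefTrace

variable {ι : Type*} [LinearOrder ι]

/-- The Jordan–Wigner sign is unimodular: `star (jwSign i s) * jwSign i s = 1`. [folklore] -/
theorem star_jwSign_mul_self (i : ι) (s : Finset ι) : star (jwSign i s) * jwSign i s = 1 := by
  unfold jwSign
  rw [star_pow, Complex.star_def, map_neg, map_one, ← mul_pow, neg_one_mul, neg_neg, one_pow]

variable [Fintype ι]

/-- Action of the annihilation operator in the occupation basis: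
`(c_i φ)(s) = jwSign i s · φ(s ∪ {i})` if `i ∉ s`, and `0` otherwise.
Bratteli–Robinson II §5.2.2. [folklore] -/
theorem annihilation_mulVec_apply (i : ι) (φ : Fock ι) (s : Finset ι) :
    (annihilation i *ᵥ φ) s = if i ∉ s then jwSign i s * φ (insert i s) else 0 := by
  simp only [Matrix.mulVec, dotProduct, annihilation]
  by_cases hi : i ∈ s
  · simp [hi]
  · simp [hi]

/-- `c_i` lowers the particle number by one: if `ψ` is an `N`-particle vector then `c_i ψ` is an
`(N - 1)`-particle vector (for `N = 0` it vanishes). Tasaki (2020) §9.2. [folklore] -/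
theorem isNParticle_annihilation_mulVec {N : ℕ} {ψ : Fock ι} (hψ : IsNParticle N ψ) (i : ι) :
    IsNParticle (N - 1) (annihilation i *ᵥ ψ) := by
  intro s hs
  rw [annihilation_mulVec_apply]
  by_cases hi : i ∈ s
  · rw [if_neg (not_not_intro hi)]
  · rw [if_pos hi, hψ _ (fun h => hs ?_), mul_zero]
    rw [Finset.card_insert_of_notMem hi] at h
    omega

/-- `‖c_i φ‖²` as a sum over occupied configurations:
`⟨c_i φ, c_i φ⟩ = Σ_{t ∋ i} |φ t|²`. [folklore] -/
theorem star_annihilation_mulVec_dotProduct (φ : Fock ι) (i : ι) :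
    star (annihilation i *ᵥ φ) ⬝ᵥ (annihilation i *ᵥ φ) =
      ∑ t : Finset ι, if i ∈ t then star (φ t) * φ t else 0 := by
  have lhs : star (annihilation i *ᵥ φ) ⬝ᵥ (annihilation i *ᵥ φ) =
      ∑ s : Finset ι, if i ∉ s then star (φ (insert i s)) * φ (insert i s) else 0 := by
    simp only [dotProduct, Pi.star_apply, annihilation_mulVec_apply]
    refine Finset.sum_congr rfl fun s _ => ?_
    by_cases h : i ∈ s
    · rw [if_neg (not_not_intro h), if_neg (not_not_intro h), star_zero, mul_zero]
    · rw [if_pos h, if_pos h, star_mul', mul_mul_mul_comm, star_jwSign_mul_self, one_mul]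
  rw [lhs, ← Finset.sum_filter, ← Finset.sum_filter]
  refine Finset.sum_nbij' (insert i) (fun t => t.erase i) ?_ ?_ ?_ ?_ ?_
  · intro s hs
    simp only [Finset.mem_filter, Finset.mem_univ, true_and] at hs ⊢
    exact Finset.mem_insert_self i s
  · intro t ht
    simp only [Finset.mem_filter, Finset.mem_univ, true_and] at ht ⊢
    exact Finset.notMem_erase i t
  · intro s hs
    simp only [Finset.mem_filter, Finset.mem_univ, true_and] at hs
    exact Finset.erase_insert hs
  · intro t ht
    simp only [Finset.mem_filter, Finset.mem_univ, true_and] at ht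
    exact Finset.insert_erase ht
  · intro s _
    rfl

/-- Summing `c†_i c_i` over all orbitals gives the number operator:
`Σ_i ‖c_i φ‖² = Σ_t |t| · |φ t|²`. Tasaki (2020) §9.2. [folklore] -/
theorem sum_star_annihilation_mulVec_dotProduct (φ : Fock ι) :
    ∑ i, star (annihilation i *ᵥ φ) ⬝ᵥ (annihilation i *ᵥ φ) =
      ∑ t : Finset ι, (t.card : ℂ) * (star (φ t) * φ t) := by
  simp only [star_annihilation_mulVec_dotProduct]
  rw [Finset.sum_comm]
  refine Finset.sum_congr rfl fun t _ => ?_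
  rw [Finset.sum_ite_mem, Finset.univ_inter, Finset.sum_const, nsmul_eq_mul]

/-- For an `M`-particle vector, `Σ_i ‖c_i φ‖² = M ‖φ‖²`. Tasaki (2020) §9.2.
[folklore] -/
theorem sum_star_annihilation_mulVec_dotProduct_of_isNParticle {M : ℕ} {φ : Fock ι}
    (hφ : IsNParticle M φ) :
    ∑ i, star (annihilation i *ᵥ φ) ⬝ᵥ (annihilation i *ᵥ φ) =
      (M : ℂ) * (star φ ⬝ᵥ φ) := by
  rw [sum_star_annihilation_mulVec_dotProduct, dotProduct, Finset.mul_sum]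
  refine Finset.sum_congr rfl fun t _ => ?_
  by_cases ht : t.card = M
  · rw [ht]; rfl
  · rw [hφ t ht]; simp

omit [LinearOrder ι] in
/-- `⟨ψ, Xᴴ Y ψ⟩ = ⟨X ψ, Y ψ⟩`. [folklore] -/
theorem expect_conjTranspose_mul (X Y : Matrix (Finset ι) (Finset ι) ℂ) (ψ : Fock ι) :
    expect (Xᴴ * Y) ψ = star (X *ᵥ ψ) ⬝ᵥ (Y *ᵥ ψ) := by
  rw [expect, ← Matrix.mulVec_mulVec, Matrix.dotProduct_mulVec, Matrix.star_mulVec]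

/-- The entries of `ρ₂` as inner products of two-hole vectors:
`ρ₂((i,j),(k,l)) = ⟨c_j c_i ψ, c_l c_k ψ⟩`. Yang (1962) §3. [folklore] -/
theorem twoParticleRDM_apply (ψ : Fock ι) (p q : ι × ι) :
    twoParticleRDM ψ p q =
      star ((annihilation p.2 * annihilation p.1) *ᵥ ψ) ⬝ᵥ
        ((annihilation q.2 * annihilation q.1) *ᵥ ψ) := by
  rw [← expect_conjTranspose_mul, Matrix.conjTranspose_mul]
  simp only [twoParticleRDM, creation, Matrix.mul_assoc]

/-- `ρ₂` is a Gram matrix, hence positive semidefinite (for every Fock vector `ψ`; no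
particle-number or normalisation hypothesis is needed). Yang (1962) §3; Xiang–Wu, *D-wave
Superconductivity* (2022), eq. (1.69), p. 26 ("ρ and ρ₂ are semi-positive definite").
[cite: XiangWu2022, eq. (1.69)] -/
theorem twoParticleRDM_posSemidef (ψ : Fock ι) : (twoParticleRDM ψ).PosSemidef := by
  let B : Matrix (Finset ι) (ι × ι) ℂ :=
    Matrix.of fun s p => ((annihilation p.2 * annihilation p.1) *ᵥ ψ) s
  have hB : twoParticleRDM ψ = Bᴴ * B := by
    ext p q
    rw [twoParticleRDM_apply, Matrix.mul_apply]
    simp [B, dotProduct]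
  rw [hB]
  exact Matrix.posSemidef_conjTranspose_mul_self B

/-- `tr ρ₂ = N(N − 1)` for a normalised `N`-particle vector. Yang (1962) §3. [folklore] -/
theorem twoParticleRDM_trace {N : ℕ} {ψ : Fock ι} (hψ : IsNParticle N ψ)
    (hnorm : star ψ ⬝ᵥ ψ = 1) : (twoParticleRDM ψ).trace = N * (N - 1 : ℂ) := by
  have h1 : (twoParticleRDM ψ).trace = ∑ i, ∑ j,
      star (annihilation j *ᵥ (annihilation i *ᵥ ψ)) ⬝ᵥ
        (annihilation j *ᵥ (annihilation i *ᵥ ψ)) := by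
    simp only [Matrix.trace, Matrix.diag_apply, twoParticleRDM_apply, ← Matrix.mulVec_mulVec]
    rw [Fintype.sum_prod_type]
  have h2 : ∀ i, ∑ j, star (annihilation j *ᵥ (annihilation i *ᵥ ψ)) ⬝ᵥ
      (annihilation j *ᵥ (annihilation i *ᵥ ψ)) =
        ((N - 1 : ℕ) : ℂ) * (star (annihilation i *ᵥ ψ) ⬝ᵥ (annihilation i *ᵥ ψ)) :=
    fun i => sum_star_annihilation_mulVec_dotProduct_of_isNParticle
      (isNParticle_annihilation_mulVec hψ i)
  rw [h1]
  simp only [h2]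
  rw [← Finset.mul_sum, sum_star_annihilation_mulVec_dotProduct_of_isNParticle hψ, hnorm,
    mul_one]
  cases N with
  | zero => simp
  | succ k => push_cast; ring

end PosSemidefTrace

/-! ### The discharge -/

section Discharge

variable {ι : Type*} [LinearOrder ι] [Fintype ι]

/-- Discharge of `twoParticleRDM_posSemidef_and_trace` (hubbard.S06): for a normalised
`N`-particle state, Yang's two-particle reduced density matrix `ρ₂` is positive semidefinite
(it is the Gram matrix of the two-hole vectors `c_j c_i ψ`) and
`tr ρ₂ = Σ_{i,j} ‖c_j c_i ψ‖² = N(N − 1)` (the sum `Σ_i c†_i c_i` is the number operator).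
Yang, Rev. Mod. Phys. 34 (1962) 694, §3 (normalisation `Tr ρ₂ = N(N − 1)` and positivity of
the reduced density matrices); see also Xiang–Wu, *D-wave Superconductivity* (2022),
eq. (1.69), p. 26 for the positivity remark. [cite: YangODLRO1962, §3] -/
theorem twoParticleRDM_posSemidef_and_trace_holds :
    twoParticleRDM_posSemidef_and_trace (ι := ι) := by
  intro N ψ hψ hnorm
  exact ⟨PosSemidefTrace.twoParticleRDM_posSemidef ψ,
    PosSemidefTrace.twoParticleRDM_trace hψ hnorm⟩

end Discharge

end Literature.MathematicalPhysics.QuantumLattice
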